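import Literature.Probability.RandomPlanarGeometry.HexSAWRotSurfaceFugacity
import HarnessLib

/-!
# An explicit rate for Beaton's Corollary 10 in the rotated frame: `0 ≤ y_{H+1} − y† ≤ K · B_H(x_c)` with `K ≤ 12`

Topic `Literature/Probability/RandomPlanarGeometry` (continues the rotated capstone `HexSAWRotSurfaceFugacity.lean` — the lane
thresholds `HV.rotYT H` (below `y_H` the `y`-weighted top class `W ↦ B^{→}_{H,W+1}(x_c; y)` of Beaton's rotated strip `D(H, W)` is
bounded), `HV.rotYdagger_le_rotYT : y† ≤ y_H` (`H ≥ 2`), Beaton's Proposition 11 made finite (`HV.rotStripByUnbounded_holds`) and the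
capstone `HV.tendsto_rotYT : y_H → y†`; with the tree's `HV.rotStripBR H W = B^{→}_{H,W}(x_c)` (`HexSAWRotStripClasses`), its width
supremum `B_H(x_c) := ⨆_W B^{→}_{H,W}(x_c)` (`HexSAWRotStripLimit`: `HV.iSup_rotStripBR_le_xc`, `HV.iSup_rotStripBR_pos`) and T3
`HV.iSup_rotStripBR_le_log : ∃ C, ∀ H ≥ 2, B_H(x_c) ≤ C (log H)^{-1/3}` (`HexSAWRotStripLogDecay`)).
Source: N. R. Beaton, *The critical surface fugacity of self-avoiding walks on a rotated honeycomb lattice*, J. Phys. A 47 (2014)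
075003, arXiv:1210.0274v3 — §3.2 Corollary 10 (p. 15: "`y_T` decreases to the critical fugacity `y_c` as `T → ∞`"), §4 Proposition 11
(statement p. 17, proof p. 18) and the coefficient `c_B(y)` of the identity (21) (p. 16: "`c_B(y)` is a continuous and monotone decreasing
function of `y` …, and `c_B(y†) = 0`"), Appendix Theorem 14 / Corollary 15 (p. 19: `B_T(x_c) → 0`).

## What is proved (lane «pcv-sawmu», a-idea-1 gen 24, lens «bridge decompositions with explicit rates»; all statements PROVED, no `sorry`)

Print (Cor. 10) and the tree (`tendsto_rotYT`) have the qualitative limit `y_H → y†` only: the capstone runs Beaton's contradiction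
"for `H ≥ H₀(y)`", with `H₀` extracted from the limit `B_H(x_c) → 0`.  This file extracts the FINITE-`H` content of the same argument —
the rotated-frame twin of the Duminil-Copin–Smirnov-frame excess bound `y_{T+1} − y* ≤ B_T(x_c, 1)` (`HexSAWStripSurfaceThresholdExcess`):

* `rotTop_succ_not_bddAbove_of_iSup_le` — **Proposition 11 at finite height**: if `H ≥ 1`, `y† < t < y` and
  `σ · x_c⁻¹ · B_H(x_c) ≤ b(t)` (`σ := 2sin(3π/16) + 2sin(π/16) + 2cos(7π/16)`, `b(t) = HV.rotBneg t = −c_B(t) > 0`), then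
  `W ↦ B^{→}_{H+1,W+1}(x_c; y)` is unbounded; hence `rotYT_succ_le_of_iSup_le : y_{H+1} ≤ y`;
* `rotBneg_ge_linear` — the coefficient is at least linear above `y†` on the relevant range:
  `κ (t − y†) ≤ b(t)` for `y† ≤ t ≤ 2 + √2`, `κ := 4cos(5π/16) x_c⁴ y† / (1 + x_c)`;
* `rotYT_le_two_add_sqrt_two` — `y_H ≤ 2 + √2` (`H ≥ 2`; the zig-zag face UB of the tree);
* ★ **`rotYT_succ_sub_rotYdagger_le`** — for every `H ≥ 1`:
  `y_{H+1} − y† ≤ K · B_H(x_c)`, `K := σ x_c⁻¹ (1 + x_c) / (4 cos(5π/16) x_c⁴ y†)` (= 11.5…), and `rotYT_succ_mem_Icc`: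
  `y_{H+1} ∈ [y†, y† + K · B_H(x_c)]` (lower half = the tree's `rotYdagger_le_rotYT`);
  NORMALISATION (token RY-2): throughout, `B_H(x_c) = ⨆_W rotStripBR H W` is the tree's RIGHT-STARTED HALF `B^{→}` of Beaton's
  symmetric `B_{T,L}` (printed `B_T = 2·B^{→}`; printed identity ⇒ `B_T ≤ 2x_c`, tree `B^{→} ≤ x_c`), so the lane constant `K ≤ 12`
  against `B^{→}` reads `K ≤ 6` against Beaton's `B_T`;
* ★ `rotYT_succ_sub_rotYdagger_le_twelve_mul` (reindexed `rotYT_sub_rotYdagger_le_twelve_mul`) — the numeral form `y_{H+1} − y† ≤ 12 · B_H(x_c)` (from `x_c ∈ [0.54119, 0.5412]`,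
  `y† ≥ 2.455`, `sin(π/16) ≤ π/16`, `cos(5π/16) ≥ 0.5546`), and `rotYT_succ_sub_rotYdagger_lt_seven : y_{H+1} − y† < 7`
  (`B_H(x_c) ≤ x_c`);
* `le_iSup_rotStripBR_of_lt_rotYT` — read backwards: a threshold excess FORCES bridge mass, `y† < y < y_{H+1} ⇒ (y − y†)/K ≤ B_H(x_c)`;
* ★ `rotYT_sub_rotYdagger_le_log` — with T3: `∃ C, ∀ H ≥ 2, y_{H+1} − y† ≤ C (log H)^{-1/3}` — Corollary 10's
  «`y_T` decreases to `y_c`» WITH A RATE (a very weak one; print EXPECTS `B_T ~ T^{-1/4}` — Beaton–Bousquet-Mélou–de Gier–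
  Duminil-Copin–Guttmann, CMP 326 (2014), §4.4 Remark 2 (arXiv:1109.0358v5 p. 14); Beaton–Guttmann–Jensen, arXiv:1110.1141v2
  p. 6 — which would give `O(H^{-1/4})`).

Not in print in this form (label for lit-1 to decide; author's guess: NEW-IN-WRITING XS–S, same derivation family as the DCS-frame
`HexSAWStripSurfaceThresholdExcess`); no claim beyond «the finite-height content of Beaton's own Proposition 11 argument, with constants».
-/

noncomputable section

open Finset Filter Topology

namespace Literature.Probability.RandomPlanarGeometry.SAW.HV

/-! ### Proposition 11 at finite height -/

/-- **Proposition 11 at finite height.**  Let `H ≥ 1` and `y† < t < y`.  If the width supremum of Beaton's bridge partition function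
at height `H` is so small that `σ · x_c⁻¹ · B_H(x_c) ≤ b(t)` (`σ = 2sin(3π/16) + 2sin(π/16) + 2cos(7π/16)`, `b(t) = −c_B(t)`), then the
`y`-weighted top class of `D(H+1, ·)` is unbounded in the width.  (The capstone's `rotStripByUnbounded_holds` is this statement with
the hypothesis discharged "for `H` large" by `B_H(x_c) → 0`; the proof is the same identity bookkeeping: Prop. 6 at `t` on the odd domains
`D(H+1, W)`, Prop. 4 on `D(H, W)`, the last-contact cut, then `W → ∞`: the lateral class at `t` tends to `0` by the lane's interpolation
lemma while `B^{→}_{H,W}(x_c) → B_H(x_c) > 0`.)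
[cite: Beaton2014RotatedHoneycomb, §4, Proposition 11 (arXiv v3 p. 17) and its proof (p. 18); identity (21) with c_B(y) (p. 16)] -/
theorem rotTop_succ_not_bddAbove_of_iSup_le {H : ℕ} (hH : 1 ≤ H) {t y : ℝ} (ht : rotYdagger < t) (hty : t < y)
    (hB : (2 * Real.sin (3 * Real.pi / 16) + 2 * Real.sin (Real.pi / 16) + 2 * Real.cos (7 * Real.pi / 16)) *
        hexCriticalFugacity⁻¹ * (⨆ Wd : ℕ, rotStripBR H Wd) ≤ rotBneg t) :
    ¬ BddAbove (Set.range fun Wd : ℕ =>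
      rotGFy ((rotStripV (H + 1) (Wd + 1)).erase wOut) (H + 1) (IsRotTopDart (H + 1)) y) := by
  intro hbdd
  have hx : 0 < hexCriticalFugacity := hexCriticalFugacity_pos_lt_one.1
  have hy : rotYdagger < y := ht.trans hty
  have ht0 : 0 < t := rotYdagger_pos.trans ht
  set b : ℝ := rotBneg t with hbdef
  have hb : 0 < b := rotBneg_pos ht
  have hs3 : 0 < Real.sin (3 * Real.pi / 16) :=
    Real.sin_pos_of_pos_of_lt_pi (by positivity) (by linarith [Real.pi_pos])
  have hs1 : 0 < Real.sin (Real.pi / 16) :=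
    Real.sin_pos_of_pos_of_lt_pi (by positivity) (by linarith [Real.pi_pos])
  have hc1 : 0 < Real.cos (Real.pi / 16) :=
    Real.cos_pos_of_mem_Ioo ⟨by linarith [Real.pi_pos], by linarith [Real.pi_pos]⟩
  have hc3 : 0 < Real.cos (3 * Real.pi / 16) :=
    Real.cos_pos_of_mem_Ioo ⟨by linarith [Real.pi_pos], by linarith [Real.pi_pos]⟩
  have hc7 : 0 < Real.cos (7 * Real.pi / 16) :=
    Real.cos_pos_of_mem_Ioo ⟨by linarith [Real.pi_pos], by linarith [Real.pi_pos]⟩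
  set σ : ℝ := 2 * Real.sin (3 * Real.pi / 16) + 2 * Real.sin (Real.pi / 16) + 2 * Real.cos (7 * Real.pi / 16) with hσdef
  set c : ℝ := hexCriticalFugacity⁻¹ with hcdef
  have hBH : σ * c * (⨆ Wd : ℕ, rotStripBR H Wd) ≤ b := hB
  obtain ⟨K, hK⟩ := hbdd
  have hKW : ∀ Wd : ℕ, 1 ≤ Wd → rotGFy ((rotStripV (H + 1) Wd).erase wOut) (H + 1) (IsRotTopDart (H + 1)) y ≤ K := by
    intro Wd hWd
    refine hK ⟨Wd - 1, ?_⟩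
    show rotGFy ((rotStripV (H + 1) (Wd - 1 + 1)).erase wOut) (H + 1) (IsRotTopDart (H + 1)) y =
      rotGFy ((rotStripV (H + 1) Wd).erase wOut) (H + 1) (IsRotTopDart (H + 1)) y
    rw [Nat.sub_add_cancel hWd]
  -- the key inequality on the odd domains `D(H+1, W)`, at `t`
  have hlow : ∀ Wd : ℕ, 1 ≤ Wd → Odd (H + 1 + Wd) →
      2 * Real.cos (Real.pi / 16) * rotStripBR H Wd ≤
        2 * Real.cos (3 * Real.pi / 16) *
          rotGFy ((rotStripV (H + 1) Wd).erase wOut) (H + 1) (IsRotLatDart (H + 1) Wd) t := by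
    intro Wd hWd hodd
    have hid := rotStrip_identityY (H := H + 1) (Wd := Wd) (by omega) hWd hodd ht0
    rw [rotB_coeff_eq ht0] at hid
    have hid0 := rotStrip_identity (H := H) (Wd := Wd) hH hWd
    have hcut := rot_arch_cut_iSup (H := H) hH Wd ht0.le
    dsimp only at hcut
    obtain ⟨hcO, hcI, hcP⟩ := hcut
    rw [← rotStripBR_eq_rotGF H Wd] at hid0
    have hT0 : 0 ≤ rotGFy ((rotStripV (H + 1) Wd).erase wOut) (H + 1) (IsRotTopDart (H + 1)) t :=
      rotGFy_nonneg _ _ _ ht0.le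
    have hLat0 : 0 ≤ rotGF ((rotStripV H Wd).erase wOut) (IsRotLatDart H Wd) := rotStripLat_nonneg H Wd
    have h4 := mul_le_mul_of_nonneg_right hBH hT0
    have h5 := mul_le_mul_of_nonneg_left hcO (mul_pos two_pos hs3).le
    have h6 := mul_le_mul_of_nonneg_left hcI (mul_pos two_pos hs1).le
    have h7 := mul_le_mul_of_nonneg_left hcP (mul_pos two_pos hc7).le
    have hcB : 2 * ((Real.cos (Real.pi / 16) - hexCriticalFugacity ^ 2 * t ^ 2 * Real.cos (5 * Real.pi / 16)) /
        (hexCriticalFugacity * t * (1 + hexCriticalFugacity * t))) = -b := by rw [hbdef, rotBneg, neg_neg]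
    rw [hcB] at hid
    have hσT : σ * c * (⨆ Wd : ℕ, rotStripBR H Wd) *
          rotGFy ((rotStripV (H + 1) Wd).erase wOut) (H + 1) (IsRotTopDart (H + 1)) t =
        2 * Real.sin (3 * Real.pi / 16) * (c * rotGFy ((rotStripV (H + 1) Wd).erase wOut) (H + 1) (IsRotTopDart (H + 1)) t *
            (⨆ Wd : ℕ, rotStripBR H Wd)) +
          2 * Real.sin (Real.pi / 16) * (c * rotGFy ((rotStripV (H + 1) Wd).erase wOut) (H + 1) (IsRotTopDart (H + 1)) t *
            (⨆ Wd : ℕ, rotStripBR H Wd)) +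
          2 * Real.cos (7 * Real.pi / 16) * (c * rotGFy ((rotStripV (H + 1) Wd).erase wOut) (H + 1) (IsRotTopDart (H + 1)) t *
            (⨆ Wd : ℕ, rotStripBR H Wd)) := by
      rw [hσdef]; ring
    linarith [mul_nonneg hb.le hT0, mul_nonneg hc3.le hLat0, h4, h5, h6, h7, hid, hid0, hσT]
  -- `W → ∞` along the right parity: `E^{⊥}(t) → 0` (interpolation lemma) but `B^{→}_{H,W}(x_c) → B_H(x_c) > 0`
  have hBpos : 0 < ⨆ Wd : ℕ, rotStripBR H Wd := iSup_rotStripBR_pos hH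
  obtain ⟨r, hr⟩ : ∃ r : ℕ, ∀ m : ℕ, 1 ≤ 2 * m + r ∧ Odd (H + 1 + (2 * m + r)) := by
    rcases Nat.even_or_odd H with ⟨k, hk⟩ | ⟨k, hk⟩
    · exact ⟨2, fun m => ⟨by omega, ⟨k + m + 1, by omega⟩⟩⟩
    · exact ⟨1, fun m => ⟨by omega, ⟨k + m + 1, by omega⟩⟩⟩
  have hφ : Tendsto (fun m : ℕ => 2 * m + r) atTop atTop :=
    tendsto_atTop_mono (fun m => show m ≤ 2 * m + r by omega) tendsto_id
  have hE' : Tendsto (fun m : ℕ =>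
      rotGFy ((rotStripV (H + 1) (2 * m + r)).erase wOut) (H + 1) (IsRotLatDart (H + 1) (2 * m + r)) t) atTop (𝓝 0) :=
    tendsto_rotLat_of_top_bdd (H := H + 1) (W := fun m => 2 * m + r) (by omega) ht0.le hty hy hφ
      (fun m => (hr m).1) (fun m => (hr m).2) (fun m => hKW _ (hr m).1)
  have hB' : Tendsto (fun m : ℕ => rotStripBR H (2 * m + r)) atTop (𝓝 (⨆ Wd : ℕ, rotStripBR H Wd)) :=
    (tendsto_rotStripBR hH).comp hφ
  have hthr : (0 : ℝ) < Real.cos (Real.pi / 16) * (⨆ Wd : ℕ, rotStripBR H Wd) / (2 * Real.cos (3 * Real.pi / 16)) :=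
    div_pos (mul_pos hc1 hBpos) (mul_pos two_pos hc3)
  have hev1 := hE'.eventually_lt_const hthr
  have hev2 := hB'.eventually_const_lt (half_lt_self hBpos)
  obtain ⟨m, hm1, hm2⟩ := (hev1.and hev2).exists
  have hkey := hlow (2 * m + r) (hr m).1 (hr m).2
  have h8 : 2 * Real.cos (3 * Real.pi / 16) *
      rotGFy ((rotStripV (H + 1) (2 * m + r)).erase wOut) (H + 1) (IsRotLatDart (H + 1) (2 * m + r)) t <
        Real.cos (Real.pi / 16) * (⨆ Wd : ℕ, rotStripBR H Wd) := by
    have := mul_lt_mul_of_pos_left hm1 (mul_pos two_pos hc3)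
    calc 2 * Real.cos (3 * Real.pi / 16) *
          rotGFy ((rotStripV (H + 1) (2 * m + r)).erase wOut) (H + 1) (IsRotLatDart (H + 1) (2 * m + r)) t
        < 2 * Real.cos (3 * Real.pi / 16) *
          (Real.cos (Real.pi / 16) * (⨆ Wd : ℕ, rotStripBR H Wd) / (2 * Real.cos (3 * Real.pi / 16))) := this
      _ = Real.cos (Real.pi / 16) * (⨆ Wd : ℕ, rotStripBR H Wd) := by field_simp
  have h9 := mul_lt_mul_of_pos_left hm2 (mul_pos two_pos hc1)
  linarith

/-- **Proposition 11 at finite height, threshold form**: under the hypothesis of `rotTop_succ_not_bddAbove_of_iSup_le`, `y_{H+1} ≤ y`.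
[cite: Beaton2014RotatedHoneycomb, §4, Proposition 11 (arXiv v3 p. 17); §3.2 Corollary 10 (p. 15)] -/
theorem rotYT_succ_le_of_iSup_le {H : ℕ} (hH : 1 ≤ H) {t y : ℝ} (ht : rotYdagger < t) (hty : t < y)
    (hB : (2 * Real.sin (3 * Real.pi / 16) + 2 * Real.sin (Real.pi / 16) + 2 * Real.cos (7 * Real.pi / 16)) *
        hexCriticalFugacity⁻¹ * (⨆ Wd : ℕ, rotStripBR H Wd) ≤ rotBneg t) :
    rotYT (H + 1) ≤ y :=
  rotYT_le ⟨rotYdagger / 2, mem_rotBddSet_of_lt (H := H + 1) (by omega) (half_pos rotYdagger_pos) (half_lt_self rotYdagger_pos)⟩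
    (rotYdagger_pos.trans (ht.trans hty)).le (rotTop_succ_not_bddAbove_of_iSup_le hH ht hty hB)

/-! ### The coefficient `b(y) = −c_B(y)` grows at least linearly above `y†` -/

/-- `cos(π/16) = cos(5π/16) · (x_c y†)²` (the defining equation of `y†`). [cite: Beaton2014RotatedHoneycomb, §4 (c_B(y†) = 0, arXiv v3 p. 16)] -/
theorem cos_pi_div_sixteen_eq_mul_sq :
    Real.cos (Real.pi / 16) = Real.cos (5 * Real.pi / 16) * (hexCriticalFugacity * rotYdagger) ^ 2 := by
  have hc5 : 0 < Real.cos (5 * Real.pi / 16) :=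
    Real.cos_pos_of_mem_Ioo ⟨by linarith [Real.pi_pos], by linarith [Real.pi_pos]⟩
  rw [sq_hexCriticalFugacity_mul_rotYdagger, mul_div_cancel₀ _ hc5.ne']

/-- `x_c · (2 + √2) = x_c⁻¹` (from `x_c² (2+√2) = 1`). [cite: DuminilCopinSmirnov2012, Theorem 1 (μ = √(2+√2))] -/
theorem hexCriticalFugacity_mul_two_add_sqrt_two : hexCriticalFugacity * (2 + Real.sqrt 2) = hexCriticalFugacity⁻¹ := by
  have hx : 0 < hexCriticalFugacity := hexCriticalFugacity_pos_lt_one.1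
  have h := hexCriticalFugacity_sq
  field_simp
  nlinarith [h]

/-- **Linear lower bound for `b(t)` on `[y†, 2 + √2]`**: `κ (t − y†) ≤ b(t)` with `κ = 4cos(5π/16) x_c⁴ y† / (1 + x_c)`
(numerator `2cos(5π/16) x_c² (t² − y†²) ≥ 4cos(5π/16) x_c² y† (t − y†)`, denominator `x_c t (1 + x_c t) ≤ x_c⁻¹(1 + x_c⁻¹) = (1 + x_c)/x_c²`).
[cite: Beaton2014RotatedHoneycomb, §4 (c_B(y) continuous, monotone decreasing, c_B(y†) = 0; arXiv v3 p. 16)] -/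
theorem rotBneg_ge_linear {t : ℝ} (ht : rotYdagger ≤ t) (htM : t ≤ 2 + Real.sqrt 2) :
    4 * Real.cos (5 * Real.pi / 16) * hexCriticalFugacity ^ 4 * rotYdagger / (1 + hexCriticalFugacity) * (t - rotYdagger) ≤
      rotBneg t := by
  have hx : 0 < hexCriticalFugacity := hexCriticalFugacity_pos_lt_one.1
  have hyd : 0 < rotYdagger := rotYdagger_pos
  have ht0 : 0 < t := hyd.trans_le ht
  have hc5 : 0 < Real.cos (5 * Real.pi / 16) :=
    Real.cos_pos_of_mem_Ioo ⟨by linarith [Real.pi_pos], by linarith [Real.pi_pos]⟩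
  have hkey := cos_pi_div_sixteen_eq_mul_sq
  -- the denominator and its bound
  have hden : 0 < hexCriticalFugacity * t * (1 + hexCriticalFugacity * t) := by positivity
  have hxt : hexCriticalFugacity * t ≤ hexCriticalFugacity⁻¹ := by
    rw [← hexCriticalFugacity_mul_two_add_sqrt_two]; exact mul_le_mul_of_nonneg_left htM hx.le
  have hdenle : hexCriticalFugacity * t * (1 + hexCriticalFugacity * t) ≤ (1 + hexCriticalFugacity) / hexCriticalFugacity ^ 2 := by
    have h1 : hexCriticalFugacity * t * (1 + hexCriticalFugacity * t) ≤ hexCriticalFugacity⁻¹ * (1 + hexCriticalFugacity⁻¹) :=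
      mul_le_mul hxt (by linarith) (by positivity) (by positivity)
    have h2 : hexCriticalFugacity⁻¹ * (1 + hexCriticalFugacity⁻¹) = (1 + hexCriticalFugacity) / hexCriticalFugacity ^ 2 := by
      field_simp; ring
    linarith [h1, h2.le]
  -- the numerator and its bound
  have hnum : 4 * Real.cos (5 * Real.pi / 16) * hexCriticalFugacity ^ 2 * rotYdagger * (t - rotYdagger) ≤
      2 * (hexCriticalFugacity ^ 2 * t ^ 2 * Real.cos (5 * Real.pi / 16) - Real.cos (Real.pi / 16)) := by
    rw [hkey]
    have h1 : 0 ≤ t - rotYdagger := sub_nonneg.2 ht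
    nlinarith [mul_nonneg (mul_nonneg hc5.le (pow_nonneg hx.le 2)) (mul_nonneg h1 h1)]
  have hnum0 : 0 ≤ 2 * (hexCriticalFugacity ^ 2 * t ^ 2 * Real.cos (5 * Real.pi / 16) - Real.cos (Real.pi / 16)) := by
    have h1 : 0 ≤ t - rotYdagger := sub_nonneg.2 ht
    have h0 : 0 ≤ 4 * Real.cos (5 * Real.pi / 16) * hexCriticalFugacity ^ 2 * rotYdagger * (t - rotYdagger) := by positivity
    linarith
  -- assemble: κ (t − y†) = (num bound) · x_c²/(1+x_c) ≤ num / den_max ≤ num / den = b(t)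
  have hb : rotBneg t = 2 * (hexCriticalFugacity ^ 2 * t ^ 2 * Real.cos (5 * Real.pi / 16) - Real.cos (Real.pi / 16)) /
      (hexCriticalFugacity * t * (1 + hexCriticalFugacity * t)) := by
    rw [rotBneg]; ring
  rw [hb, ge_iff_le.symm, ge_iff_le, le_div_iff₀ hden]
  have hpos : 0 < (1 + hexCriticalFugacity) / hexCriticalFugacity ^ 2 := by positivity
  calc 4 * Real.cos (5 * Real.pi / 16) * hexCriticalFugacity ^ 4 * rotYdagger / (1 + hexCriticalFugacity) * (t - rotYdagger) *
        (hexCriticalFugacity * t * (1 + hexCriticalFugacity * t))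
      ≤ 4 * Real.cos (5 * Real.pi / 16) * hexCriticalFugacity ^ 4 * rotYdagger / (1 + hexCriticalFugacity) * (t - rotYdagger) *
        ((1 + hexCriticalFugacity) / hexCriticalFugacity ^ 2) := by
          refine mul_le_mul_of_nonneg_left hdenle ?_
          have h1 : 0 ≤ t - rotYdagger := sub_nonneg.2 ht
          positivity
    _ = 4 * Real.cos (5 * Real.pi / 16) * hexCriticalFugacity ^ 2 * rotYdagger * (t - rotYdagger) := by
          field_simp
    _ ≤ 2 * (hexCriticalFugacity ^ 2 * t ^ 2 * Real.cos (5 * Real.pi / 16) - Real.cos (Real.pi / 16)) := hnum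

/-! ### The excess bound -/

/-- `y_H ≤ 2 + √2` for `H ≥ 2` (above `2 + √2 = x_c⁻²` the top class is unbounded: the tree's zig-zag face UB, Beaton Prop. 7 «κ(y) ≥ √y»).
[cite: Beaton2014RotatedHoneycomb, §3, Proposition 7 (arXiv v3 p. 11)] -/
theorem rotYT_le_two_add_sqrt_two {H : ℕ} (hH : 2 ≤ H) : rotYT H ≤ 2 + Real.sqrt 2 := by
  obtain ⟨H', rfl⟩ : ∃ H', H = H' + 1 := ⟨H - 1, by omega⟩
  refine le_of_forall_gt_imp_ge_of_dense fun y hy => ?_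
  have hy0 : (0 : ℝ) ≤ y := le_of_lt (lt_of_le_of_lt (by positivity) hy)
  exact rotYT_le ⟨rotYdagger / 2, mem_rotBddSet_of_lt (H := H' + 1) (by omega) (half_pos rotYdagger_pos)
    (half_lt_self rotYdagger_pos)⟩ hy0 (rotTop_not_bddAbove_large hH hy)

/-- ★ **The excess bound (rotated-frame twin of `y_{T+1} − y* ≤ B_T(x_c, 1)`)**: for every `H ≥ 1`,
`y_{H+1} − y† ≤ K · B_H(x_c)` with the explicit constant `K = σ x_c⁻¹ (1 + x_c) / (4cos(5π/16) x_c⁴ y†)`,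
`σ = 2sin(3π/16) + 2sin(π/16) + 2cos(7π/16)` (`K = 11.5…`).  Proof: if `y† + K·B_H < y ≤ 2 + √2`, run Proposition 11 at finite height
with `t` the midpoint of `y† + K·B_H` and `y` (`b(t) ≥ κ(t − y†) > κ K B_H = σ x_c⁻¹ B_H`); above `2 + √2` use `rotYT_le_two_add_sqrt_two`.
[cite: Beaton2014RotatedHoneycomb, §3.2 Corollary 10 (arXiv v3 p. 15: "y_T decreases to the critical fugacity y_c"); §4 Proposition 11 and its proof (pp. 17–18)] -/
theorem rotYT_succ_sub_rotYdagger_le {H : ℕ} (hH : 1 ≤ H) :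
    rotYT (H + 1) - rotYdagger ≤
      (2 * Real.sin (3 * Real.pi / 16) + 2 * Real.sin (Real.pi / 16) + 2 * Real.cos (7 * Real.pi / 16)) * hexCriticalFugacity⁻¹ *
          (1 + hexCriticalFugacity) / (4 * Real.cos (5 * Real.pi / 16) * hexCriticalFugacity ^ 4 * rotYdagger) *
        ⨆ Wd : ℕ, rotStripBR H Wd := by
  have hx : 0 < hexCriticalFugacity := hexCriticalFugacity_pos_lt_one.1
  have hyd : 0 < rotYdagger := rotYdagger_pos
  have hc5 : 0 < Real.cos (5 * Real.pi / 16) :=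
    Real.cos_pos_of_mem_Ioo ⟨by linarith [Real.pi_pos], by linarith [Real.pi_pos]⟩
  have hs3 : 0 < Real.sin (3 * Real.pi / 16) :=
    Real.sin_pos_of_pos_of_lt_pi (by positivity) (by linarith [Real.pi_pos])
  have hs1 : 0 < Real.sin (Real.pi / 16) :=
    Real.sin_pos_of_pos_of_lt_pi (by positivity) (by linarith [Real.pi_pos])
  have hc7 : 0 < Real.cos (7 * Real.pi / 16) :=
    Real.cos_pos_of_mem_Ioo ⟨by linarith [Real.pi_pos], by linarith [Real.pi_pos]⟩
  have hB0 : 0 ≤ ⨆ Wd : ℕ, rotStripBR H Wd := Real.iSup_nonneg fun Wd => rotStripBR_nonneg H Wd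
  -- Proposition 11 at finite height, as a function of `(t, y)`
  have P11 : ∀ t' y' : ℝ, rotYdagger < t' → t' < y' →
      (2 * Real.sin (3 * Real.pi / 16) + 2 * Real.sin (Real.pi / 16) + 2 * Real.cos (7 * Real.pi / 16)) *
        hexCriticalFugacity⁻¹ * (⨆ Wd : ℕ, rotStripBR H Wd) ≤ rotBneg t' → rotYT (H + 1) ≤ y' :=
    fun t' y' h1 h2 h3 => rotYT_succ_le_of_iSup_le hH h1 h2 h3
  -- opaque names for the constants (no `set`: keeps the trigonometric atoms folded)
  obtain ⟨σ, hσ⟩ : ∃ σ : ℝ,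
      σ = 2 * Real.sin (3 * Real.pi / 16) + 2 * Real.sin (Real.pi / 16) + 2 * Real.cos (7 * Real.pi / 16) := ⟨_, rfl⟩
  obtain ⟨B, hB⟩ : ∃ B : ℝ, B = ⨆ Wd : ℕ, rotStripBR H Wd := ⟨_, rfl⟩
  obtain ⟨κ, hκ⟩ : ∃ κ : ℝ,
      κ = 4 * Real.cos (5 * Real.pi / 16) * hexCriticalFugacity ^ 4 * rotYdagger / (1 + hexCriticalFugacity) := ⟨_, rfl⟩
  obtain ⟨K, hK⟩ : ∃ K : ℝ, K = σ * hexCriticalFugacity⁻¹ * (1 + hexCriticalFugacity) /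
      (4 * Real.cos (5 * Real.pi / 16) * hexCriticalFugacity ^ 4 * rotYdagger) := ⟨_, rfl⟩
  rw [← hσ, ← hB, ← hK]
  rw [← hB] at hB0
  rw [← hσ, ← hB] at P11
  have hσ0 : 0 < σ := by rw [hσ]; positivity
  have hκ0 : 0 < κ := by rw [hκ]; positivity
  have hK0 : 0 ≤ K := by rw [hK]; positivity
  have hκK : κ * K = σ * hexCriticalFugacity⁻¹ := by
    rw [hκ, hK]; field_simp
  rw [sub_le_iff_le_add']
  -- it suffices: every `y > y† + K B` bounds `y_{H+1}`
  refine le_of_forall_gt_imp_ge_of_dense fun y hy => ?_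
  rcases le_or_gt y (2 + Real.sqrt 2) with hyM | hyM
  · -- run Proposition 11 at finite height with the midpoint `t`
    obtain ⟨t, ht_def⟩ : ∃ t : ℝ, t = (rotYdagger + K * B + y) / 2 := ⟨_, rfl⟩
    have hta : rotYdagger + K * B < t := by rw [ht_def]; linarith
    have hty : t < y := by rw [ht_def]; linarith
    have ht : rotYdagger < t := lt_of_le_of_lt (le_add_of_nonneg_right (mul_nonneg hK0 hB0)) hta
    have htM : t ≤ 2 + Real.sqrt 2 := by linarith
    have hlin := rotBneg_ge_linear ht.le htM
    rw [← hκ] at hlin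
    have h1 : σ * hexCriticalFugacity⁻¹ * B = κ * (K * B) := by rw [← mul_assoc, hκK]
    have h2 : κ * (K * B) ≤ κ * (t - rotYdagger) := mul_le_mul_of_nonneg_left (by linarith) hκ0.le
    have hfin : σ * hexCriticalFugacity⁻¹ * B ≤ rotBneg t := by linarith [h1, h2, hlin]
    exact P11 t y ht hty hfin
  · exact (rotYT_le_two_add_sqrt_two (H := H + 1) (by omega)).trans hyM.le

/-- `y_{H+1} ∈ [y†, y† + K · B_H(x_c)]` for `H ≥ 1` (lower half: the tree's `rotYdagger_le_rotYT`).
[cite: Beaton2014RotatedHoneycomb, §3.2 Corollary 10 (arXiv v3 p. 15); §4 Lemma 12 and Proposition 11 (p. 17)] -/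
theorem rotYT_succ_mem_Icc {H : ℕ} (hH : 1 ≤ H) :
    rotYT (H + 1) ∈ Set.Icc rotYdagger (rotYdagger +
      (2 * Real.sin (3 * Real.pi / 16) + 2 * Real.sin (Real.pi / 16) + 2 * Real.cos (7 * Real.pi / 16)) * hexCriticalFugacity⁻¹ *
          (1 + hexCriticalFugacity) / (4 * Real.cos (5 * Real.pi / 16) * hexCriticalFugacity ^ 4 * rotYdagger) *
        ⨆ Wd : ℕ, rotStripBR H Wd) :=
  ⟨rotYdagger_le_rotYT (H := H + 1) (by omega), by linarith [rotYT_succ_sub_rotYdagger_le hH]⟩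

/-- Read backwards — **a threshold excess forces bridge mass**: if `y† < y < y_{H+1}` then `B_H(x_c) ≥ (y − y†)/K`.
[cite: Beaton2014RotatedHoneycomb, §4 Proposition 11 (arXiv v3 p. 17); Appendix Theorem 14 (p. 19)] -/
theorem le_iSup_rotStripBR_of_lt_rotYT {H : ℕ} (hH : 1 ≤ H) {y : ℝ} (hy : y < rotYT (H + 1)) :
    (y - rotYdagger) / ((2 * Real.sin (3 * Real.pi / 16) + 2 * Real.sin (Real.pi / 16) + 2 * Real.cos (7 * Real.pi / 16)) *
        hexCriticalFugacity⁻¹ * (1 + hexCriticalFugacity) / (4 * Real.cos (5 * Real.pi / 16) * hexCriticalFugacity ^ 4 * rotYdagger)) ≤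
      ⨆ Wd : ℕ, rotStripBR H Wd := by
  have hx : 0 < hexCriticalFugacity := hexCriticalFugacity_pos_lt_one.1
  have hyd : 0 < rotYdagger := rotYdagger_pos
  have hc5 : 0 < Real.cos (5 * Real.pi / 16) :=
    Real.cos_pos_of_mem_Ioo ⟨by linarith [Real.pi_pos], by linarith [Real.pi_pos]⟩
  have hs3 : 0 < Real.sin (3 * Real.pi / 16) :=
    Real.sin_pos_of_pos_of_lt_pi (by positivity) (by linarith [Real.pi_pos])
  have hs1 : 0 < Real.sin (Real.pi / 16) :=
    Real.sin_pos_of_pos_of_lt_pi (by positivity) (by linarith [Real.pi_pos])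
  have hc7 : 0 < Real.cos (7 * Real.pi / 16) :=
    Real.cos_pos_of_mem_Ioo ⟨by linarith [Real.pi_pos], by linarith [Real.pi_pos]⟩
  have hK : 0 < (2 * Real.sin (3 * Real.pi / 16) + 2 * Real.sin (Real.pi / 16) + 2 * Real.cos (7 * Real.pi / 16)) *
      hexCriticalFugacity⁻¹ * (1 + hexCriticalFugacity) / (4 * Real.cos (5 * Real.pi / 16) * hexCriticalFugacity ^ 4 * rotYdagger) := by
    positivity
  rw [div_le_iff₀ hK]
  have h := rotYT_succ_sub_rotYdagger_le hH
  nlinarith [h, hK]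

/-! ### Numerals: `K ≤ 12`, hence `y_{H+1} − y† ≤ 12 · B_H(x_c) < 7` -/

/-- `1.414213 < √2 < 1.414214`. [folklore] -/
private theorem sqrt_two_bounds : (1.414213 : ℝ) < Real.sqrt 2 ∧ Real.sqrt 2 < 1.414214 := by
  constructor
  · rw [show (1.414213 : ℝ) = Real.sqrt (1.414213 ^ 2) by rw [Real.sqrt_sq]; norm_num]
    exact Real.sqrt_lt_sqrt (by norm_num) (by norm_num)
  · rw [show (1.414214 : ℝ) = Real.sqrt (1.414214 ^ 2) by rw [Real.sqrt_sq]; norm_num]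
    exact Real.sqrt_lt_sqrt (by norm_num) (by norm_num)

/-- `1.847758 < √(2 + √2) < 1.84776`. [folklore] -/
private theorem sqrt_two_add_sqrt_two_bounds :
    (1.847758 : ℝ) < Real.sqrt (2 + Real.sqrt 2) ∧ Real.sqrt (2 + Real.sqrt 2) < 1.84776 := by
  obtain ⟨h1, h2⟩ := sqrt_two_bounds
  constructor
  · rw [show (1.847758 : ℝ) = Real.sqrt (1.847758 ^ 2) by rw [Real.sqrt_sq]; norm_num]
    exact Real.sqrt_lt_sqrt (by norm_num) (by norm_num; linarith)
  · rw [show (1.84776 : ℝ) = Real.sqrt (1.84776 ^ 2) by rw [Real.sqrt_sq]; norm_num]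
    exact Real.sqrt_lt_sqrt (by positivity) (by norm_num; linarith)

/-- `0.54119 < x_c < 0.5412` (`x_c = 1/√(2+√2) = 0.541196…`). [cite: DuminilCopinSmirnov2012, Theorem 1 (μ = √(2+√2) = 1.847759…)] -/
theorem hexCriticalFugacity_bounds : (0.54119 : ℝ) < hexCriticalFugacity ∧ hexCriticalFugacity < 0.5412 := by
  have hx : 0 < hexCriticalFugacity := hexCriticalFugacity_pos_lt_one.1
  obtain ⟨h1, h2⟩ := sqrt_two_bounds
  have hsq := hexCriticalFugacity_sq
  constructor
  · nlinarith [sq_nonneg (hexCriticalFugacity - 0.54119), sq_nonneg (hexCriticalFugacity + 0.54119)]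
  · nlinarith [sq_nonneg (hexCriticalFugacity - 0.5412), sq_nonneg (hexCriticalFugacity + 0.5412)]

/-- `2.455 < y†` (from the printed closed form `y† = √((2+√2)/(1+√2−√(2+√2)))` = 2.45506…). [cite: Beaton2014RotatedHoneycomb, Theorem 1 (arXiv v3 p. 2: "y_c = 2.455…")] -/
theorem rotYdagger_gt : (2.455 : ℝ) < rotYdagger := by
  obtain ⟨h1, h2⟩ := sqrt_two_bounds
  obtain ⟨h3, h4⟩ := sqrt_two_add_sqrt_two_bounds
  have hden : 0 < 1 + Real.sqrt 2 - Real.sqrt (2 + Real.sqrt 2) := by linarith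
  have hq : (2.455 : ℝ) ^ 2 < (2 + Real.sqrt 2) / (1 + Real.sqrt 2 - Real.sqrt (2 + Real.sqrt 2)) := by
    rw [lt_div_iff₀ hden]; nlinarith
  rw [rotYdagger_eq_printed, show (2.455 : ℝ) = Real.sqrt (2.455 ^ 2) by rw [Real.sqrt_sq]; norm_num]
  exact Real.sqrt_lt_sqrt (by norm_num) hq

/-- `sin(π/16) ≤ 0.19635` and `0.9807 < cos(π/16)`. [folklore] -/
private theorem sin_cos_pi_div_sixteen_bounds : Real.sin (Real.pi / 16) ≤ 0.19635 ∧ (0.9807 : ℝ) < Real.cos (Real.pi / 16) := by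
  obtain ⟨h3, h4⟩ := sqrt_two_add_sqrt_two_bounds
  constructor
  · have h := Real.sin_le (show 0 ≤ Real.pi / 16 by positivity)
    linarith [Real.pi_lt_d4]
  · rw [Real.cos_pi_div_sixteen]
    rw [show (0.9807 : ℝ) = Real.sqrt (1.9614 ^ 2) / 2 by rw [Real.sqrt_sq]; norm_num; norm_num]
    exact div_lt_div_of_pos_right (Real.sqrt_lt_sqrt (by norm_num) (by nlinarith)) two_pos

/-- `0.5546 < cos(5π/16) = sin(3π/16)` (via `cos(5π/16) = cos(π/4)cos(π/16) − sin(π/4)sin(π/16)`). [folklore] -/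
private theorem cos_five_pi_div_sixteen_gt : (0.5546 : ℝ) < Real.cos (5 * Real.pi / 16) := by
  obtain ⟨hs, hc⟩ := sin_cos_pi_div_sixteen_bounds
  obtain ⟨h1, h2⟩ := sqrt_two_bounds
  rw [show 5 * Real.pi / 16 = Real.pi / 4 + Real.pi / 16 by ring, Real.cos_add, Real.cos_pi_div_four, Real.sin_pi_div_four]
  nlinarith

/-- ★ **Numeral form: `K ≤ 12`.** [cite: Beaton2014RotatedHoneycomb, Theorem 1 (y_c = 2.455…) and §4 (the constants of identity (21))] -/
theorem rotYT_rate_const_le_twelve :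
    (2 * Real.sin (3 * Real.pi / 16) + 2 * Real.sin (Real.pi / 16) + 2 * Real.cos (7 * Real.pi / 16)) * hexCriticalFugacity⁻¹ *
        (1 + hexCriticalFugacity) / (4 * Real.cos (5 * Real.pi / 16) * hexCriticalFugacity ^ 4 * rotYdagger) ≤ 12 := by
  obtain ⟨-, -, -, -, hs3, hs1⟩ := rot_trig_facts
  have hx : 0 < hexCriticalFugacity := hexCriticalFugacity_pos_lt_one.1
  obtain ⟨hx1, hx2⟩ := hexCriticalFugacity_bounds
  have hyd := rotYdagger_gt
  obtain ⟨hsin, -⟩ := sin_cos_pi_div_sixteen_bounds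
  have hc5 := cos_five_pi_div_sixteen_gt
  have hs1' : 0 < Real.sin (Real.pi / 16) :=
    Real.sin_pos_of_pos_of_lt_pi (by positivity) (by linarith [Real.pi_pos])
  rw [hs3, ← hs1]
  have hden : 0 < 4 * Real.cos (5 * Real.pi / 16) * hexCriticalFugacity ^ 4 * rotYdagger := by positivity
  rw [div_le_iff₀ hden]
  -- clear the inverse: multiply through by x_c
  have h1 : (2 * Real.cos (5 * Real.pi / 16) + 2 * Real.sin (Real.pi / 16) + 2 * Real.sin (Real.pi / 16)) *
      hexCriticalFugacity⁻¹ * (1 + hexCriticalFugacity) =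
        (2 * Real.cos (5 * Real.pi / 16) + 4 * Real.sin (Real.pi / 16)) * (1 + hexCriticalFugacity) / hexCriticalFugacity := by
    field_simp; ring
  rw [h1, div_le_iff₀ hx]
  have hx2 : (0.29288 : ℝ) < hexCriticalFugacity ^ 2 := by nlinarith
  have hx4' : (0.08577 : ℝ) < hexCriticalFugacity ^ 4 := by nlinarith
  have hx5 : (0.0464 : ℝ) < hexCriticalFugacity ^ 5 := by nlinarith
  have hxy : (0.1139 : ℝ) < hexCriticalFugacity ^ 5 * rotYdagger := by
    nlinarith [mul_pos (sub_pos.2 hx5) (sub_pos.2 hyd)]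
  have hcxy : 0.1139 * Real.cos (5 * Real.pi / 16) < hexCriticalFugacity ^ 5 * rotYdagger * Real.cos (5 * Real.pi / 16) := by
    nlinarith [mul_pos (sub_pos.2 hxy) (show (0:ℝ) < Real.cos (5 * Real.pi / 16) by linarith)]
  have hL : (2 * Real.cos (5 * Real.pi / 16) + 4 * Real.sin (Real.pi / 16)) * (1 + hexCriticalFugacity) ≤
      (2 * Real.cos (5 * Real.pi / 16) + 4 * Real.sin (Real.pi / 16)) * 1.5412 :=
    mul_le_mul_of_nonneg_left (by linarith) (by positivity)
  have hR : 12 * (4 * Real.cos (5 * Real.pi / 16) * hexCriticalFugacity ^ 4 * rotYdagger) * hexCriticalFugacity =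
      48 * (hexCriticalFugacity ^ 5 * rotYdagger * Real.cos (5 * Real.pi / 16)) := by ring
  rw [hR]
  linarith [hL, hsin, hc5, hcxy]

/-- ★ **`y_{H+1} − y† ≤ 12 · B_H(x_c)`** for every `H ≥ 1`. [cite: Beaton2014RotatedHoneycomb, §3.2 Corollary 10 (arXiv v3 p. 15); §4 Proposition 11 (p. 17)] -/
theorem rotYT_succ_sub_rotYdagger_le_twelve_mul {H : ℕ} (hH : 1 ≤ H) :
    rotYT (H + 1) - rotYdagger ≤ 12 * ⨆ Wd : ℕ, rotStripBR H Wd := by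
  have hB0 : 0 ≤ ⨆ Wd : ℕ, rotStripBR H Wd := Real.iSup_nonneg fun Wd => rotStripBR_nonneg H Wd
  exact (rotYT_succ_sub_rotYdagger_le hH).trans (mul_le_mul_of_nonneg_right rotYT_rate_const_le_twelve hB0)

/-- Reindexed: `y_H − y† ≤ 12 · B_{H−1}(x_c)` for every `H ≥ 2` (the DCS-frame twin is `stripYT_sub_yStar_le`).
[cite: Beaton2014RotatedHoneycomb, §3.2 Corollary 10 (arXiv v3 p. 15); §4 Proposition 11 (p. 17)] -/
theorem rotYT_sub_rotYdagger_le_twelve_mul {H : ℕ} (hH : 2 ≤ H) :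
    rotYT H - rotYdagger ≤ 12 * ⨆ Wd : ℕ, rotStripBR (H - 1) Wd := by
  obtain ⟨H', rfl⟩ : ∃ H', H = H' + 1 := ⟨H - 1, by omega⟩
  rw [Nat.add_sub_cancel]
  exact rotYT_succ_sub_rotYdagger_le_twelve_mul (H := H') (by omega)

/-- `y_{H+1} − y† < 7` (`B_H(x_c) ≤ x_c < 0.5412`, the tree's `iSup_rotStripBR_le_xc`). [cite: Beaton2014RotatedHoneycomb, §4 (arXiv v3 p. 17; tree `HV.iSup_rotStripBR_le_xc`)] -/
theorem rotYT_succ_sub_rotYdagger_lt_seven {H : ℕ} (hH : 1 ≤ H) : rotYT (H + 1) - rotYdagger < 7 := by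
  have h := rotYT_succ_sub_rotYdagger_le_twelve_mul hH
  have hB := iSup_rotStripBR_le_xc hH
  linarith [hexCriticalFugacity_bounds.2]

/-! ### Corollary 10 with a rate -/

/-- ★ **Corollary 10 with a rate**: `∃ C, ∀ H ≥ 2, y_{H+1} − y† ≤ C · (log H)^{-1/3}` (T3's logarithmic decay of `B_H(x_c)` transported
by the excess bound; print: "`y_T` decreases to `y_c`", no rate; with the conjectured `B_T ~ T^{-1/4}` it would read `O(H^{-1/4})`).
[cite: Beaton2014RotatedHoneycomb, §3.2 Corollary 10 (arXiv v3 p. 15) and Appendix Theorem 14 (p. 19); GlazmanManolescu2019, Proposition 1.1] -/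
theorem rotYT_sub_rotYdagger_le_log :
    ∃ C : ℝ, ∀ H : ℕ, 2 ≤ H → rotYT (H + 1) - rotYdagger ≤ C * Real.log H ^ (-(1 : ℝ) / 3) := by
  obtain ⟨C, hC⟩ := iSup_rotStripBR_le_log
  refine ⟨12 * C, fun H hH => ?_⟩
  have h := rotYT_succ_sub_rotYdagger_le_twelve_mul (H := H) (by omega)
  have h2 := mul_le_mul_of_nonneg_left (hC H hH) (show (0:ℝ) ≤ 12 by norm_num)
  linarith [h, h2]

/-- The same on both sides: `0 ≤ y_{H+1} − y† ≤ C (log H)^{-1/3}` for `H ≥ 2`. [cite: Beaton2014RotatedHoneycomb, §3.2 Corollary 10 (arXiv v3 p. 15); §4 Lemma 12 (p. 17)] -/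
theorem abs_rotYT_sub_rotYdagger_le_log :
    ∃ C : ℝ, ∀ H : ℕ, 2 ≤ H → |rotYT (H + 1) - rotYdagger| ≤ C * Real.log H ^ (-(1 : ℝ) / 3) := by
  obtain ⟨C, hC⟩ := rotYT_sub_rotYdagger_le_log
  refine ⟨C, fun H hH => ?_⟩
  rw [abs_of_nonneg (sub_nonneg.2 (rotYdagger_le_rotYT (H := H + 1) (by omega)))]
  exact hC H hH

end Literature.Probability.RandomPlanarGeometry.SAW.HV
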